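/-
Copyright (c) 2026. All rights reserved.
Released under Apache 2.0 license as described in the file LICENSE.
Authors: HodgeCM publication cell (pub-hodgecm), model-construction sub-cell, construction prover `mc-theta-1` (gen 3).
-/
import Literature.RepresentationTheory.KonnoKonno2007.FockModelUnitaryDualPair
import Literature.Analysis.SegalBargmann.SchwartzCompactWeilRep
import HarnessLib

/-!
# Twisting an archimedean Weil datum by a unitary character; the exponent family of a junction

Topic `RepresentationTheory/KonnoKonno2007`; namespaces `Literature.NumberTheory.Weil1964` (§1, dot-notation extension
of the tree structure `IsArchWeilDatum`) and `Literature.RepresentationTheory.KonnoKonno2007` (§2).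
KERNEL ONLY — no `def … : Prop` record, no new hypothesis structure; 0 new cited facts.

* §1 `charTwist χ ω : g ↦ χ(g) • ω(g)` — the twist of a representation by a scalar character — and
  **`IsArchWeilDatum.twist`**: if `ω` is an archimedean Weil datum over `ι𝕎 : G_∞ → Sp(𝕎)` (strongly continuous on
  `𝓢`, Heisenberg-covariant over `ι𝕎`, unitary on `L²`) and `χ : G_∞ →* S¹` is a continuous unitary character, then so
  is `χ ⊗ ω` over the SAME `ι𝕎` (covariance is insensitive to scalars since `ρ(p,q)` is linear; the unitary lift is
  multiplied by the unitary scalar `χ(g)`).  This is the elementary half of the classical statement that the genuine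
  Weil representations of a group over a fixed symplectic action form a torsor under its unitary character group
  [Folland1989, Ch. 4 §2, (4.23) and the sentence before it: the intertwiner `μ(A)` "is determined up to a phase
  factor"; p. 191: on `U(n)` "with a better choice of phase factors it can be made single-valued"].
* §2 For a junction `D : RealDualPairJunction P Q R S Ginf` ([KonnoKonno2007, §3.1 (3.1)]): if the record
  `D.FockVacuumCharacter e` holds ([KonnoKonno2007, Lemma 5.2 p. 73]: a datum whose vacuum `K_V × K_W`-character is
  `det^{e_P} det^{e_Q} det^{e_R} det^{e_S}`) and `χ` is a continuous unitary character of `Ginf` whose restriction to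
  the maximal compact is the determinant-power character `vacScalar e'`, then `D.FockVacuumCharacter (e + e')`
  (`FockVacuumCharacter.twist`).  In particular with characters restricting to `(det a · det b)^m` and
  `(det c · det d)^{m'}` — the determinant of `G_V`, resp. `G_W`, composed with the block inclusion of its maximal
  compact, as an instance supplies them — EVERY tuple with the same differences `e_P − e_Q`, `e_R − e_S` is realised
  (`FockVacuumCharacter.of_sub_eq_sub`): the exponent family of a junction contains, with `e`, the affine plane
  `e + (m, m, m′, m′)`; the differences are pinned by the junction's `SL₂`-frames (`JunctionVacuumCirclePin`) while the
  sums shift by `(2m, 2m′)` — the integer avatar of the twisting parameters of [KonnoKonno2007, §4.1 p. 49: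
  `ξ(z) = (z/z̄)^{m/2}`, `ξ′(z) = (z/z̄)^{m′/2}`].

References: [KonnoKonno2007] §3.1, §3.3 p. 47, §4.1 p. 49, Lemma 5.2 p. 73; [Folland1989] Ch. 4 §2 (4.23), p. 191.
-/

noncomputable section

open Complex SchwartzMap Matrix MeasureTheory

/-! ## 1. Twisting a datum by a unitary character -/

namespace Literature.NumberTheory.Weil1964

open Literature.Analysis.SegalBargmann Literature.RepresentationTheory.HeisenbergGroup

section TwistRep

variable {G V : Type*} [Group G] [AddCommGroup V] [Module ℂ V]

/-- **Twist of a representation by a scalar character**: `g ↦ χ(g) • ω(g)`. [folklore] -/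
def charTwist (χ : G →* ℂ) (ω : Representation ℂ G V) : Representation ℂ G V where
  toFun g := χ g • ω g
  map_one' := by rw [map_one, map_one, one_smul]
  map_mul' g h := by
    refine LinearMap.ext fun v => ?_
    simp only [map_mul, LinearMap.smul_apply, Module.End.mul_apply, LinearMap.map_smul, smul_smul]

/-- unfolding `charTwist`. [folklore] -/
@[simp] theorem charTwist_apply (χ : G →* ℂ) (ω : Representation ℂ G V) (g : G) (v : V) :
    charTwist χ ω g v = χ g • ω g v := rfl

/-- the operator of the twist. [folklore] -/
theorem charTwist_apply_eq (χ : G →* ℂ) (ω : Representation ℂ G V) (g : G) :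
    charTwist χ ω g = χ g • ω g := rfl

end TwistRep

variable {σ : Type*} [Fintype σ] [DecidableEq σ] {Ginf : Type*} [Group Ginf] [TopologicalSpace Ginf]
  {ι𝕎 : Ginf →* symplecticGroup (polar (dotPairing σ))} {ω : Representation ℂ Ginf (SchwartzMap (σ → ℝ) ℂ)}

omit [DecidableEq σ] in
/-- **The twist of an archimedean Weil datum by a continuous unitary character is an archimedean Weil datum over the
same symplectic action**: strong continuity on `𝓢` (product of a continuous scalar and a continuous orbit map),
Heisenberg covariance (`ρ(p,q)` is linear) and unitarity on `L²` (the lift is multiplied by the unitary scalar `χ g`).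
[cite: Folland1989, Ch. 4 §2, (4.23)] [folklore] -/
theorem IsArchWeilDatum.twist (hW : IsArchWeilDatum ι𝕎 ω) (χ : Ginf →* Circle) (hχ : Continuous χ) :
    IsArchWeilDatum ι𝕎 (charTwist (Circle.coeHom.comp χ) ω) where
  continuous_apply f := by
    change Continuous fun g => (((χ g : Circle) : ℂ) • ω g) f
    simp only [LinearMap.smul_apply]
    exact (continuous_subtype_val.comp hχ).smul (hW.continuous_apply f)
  covariant h p q f := by
    change (((χ h : Circle) : ℂ) • ω h) (rhoS p q f) = rhoS _ _ ((((χ h : Circle) : ℂ) • ω h) f)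
    simp only [LinearMap.smul_apply, map_smul]
    rw [hW.covariant h p q f]
  exists_lift g := by
    obtain ⟨U, hU⟩ := hW.exists_lift g
    refine ⟨U.trans (circleSmulLIE (Lp ℂ 2 (volume : Measure (σ → ℝ))) (χ g)), fun f => ?_⟩
    change toL2 ((((χ g : Circle) : ℂ) • ω g) f) = circleSmulLIE (Lp ℂ 2 (volume : Measure (σ → ℝ))) (χ g) (U (toL2 f))
    rw [LinearMap.smul_apply, map_smul, hU f, circleSmulLIE_apply]
    rfl

omit [DecidableEq σ] [TopologicalSpace Ginf] in
/-- the twisted datum's operators: `(χ ⊗ ω)(g) f = χ(g) • ω(g) f`. [folklore] -/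
theorem charTwist_circle_apply (χ : Ginf →* Circle) (g : Ginf) (f : SchwartzMap (σ → ℝ) ℂ) :
    charTwist (Circle.coeHom.comp χ) ω g f = ((χ g : Circle) : ℂ) • ω g f := rfl

end Literature.NumberTheory.Weil1964

/-! ## 2. The exponent family of a junction -/

namespace Literature.RepresentationTheory.KonnoKonno2007

open Literature.Analysis.SegalBargmann Literature.RepresentationTheory.HeisenbergGroup
open Literature.NumberTheory.Weil1964

variable {P Q R S : Type*} [Fintype P] [DecidableEq P] [Fintype Q] [DecidableEq Q] [Fintype R]
  [DecidableEq R] [Fintype S] [DecidableEq S] {Ginf : Type*} [Group Ginf] [TopologicalSpace Ginf]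

namespace VacExponents

/-- componentwise sum of exponent tuples (the product of the two determinant-power characters). [folklore] -/
instance : Add VacExponents := ⟨fun e e' => ⟨e.eP + e'.eP, e.eQ + e'.eQ, e.eR + e'.eR, e.eS + e'.eS⟩⟩

/-- projection of a sum. [folklore] -/
@[simp] theorem add_eP (e e' : VacExponents) : (e + e').eP = e.eP + e'.eP := rfl
/-- projection of a sum. [folklore] -/
@[simp] theorem add_eQ (e e' : VacExponents) : (e + e').eQ = e.eQ + e'.eQ := rfl
/-- projection of a sum. [folklore] -/
@[simp] theorem add_eR (e e' : VacExponents) : (e + e').eR = e.eR + e'.eR := rfl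
/-- projection of a sum. [folklore] -/
@[simp] theorem add_eS (e e' : VacExponents) : (e + e').eS = e.eS + e'.eS := rfl

/-- the `G_V`-determinant twist parameter `m`: exponents `(m, m, 0, 0)`. [folklore] -/
def detV (m : ℤ) : VacExponents := ⟨m, m, 0, 0⟩
/-- the `G_W`-determinant twist parameter `m′`: exponents `(0, 0, m′, m′)`. [folklore] -/
def detW (m' : ℤ) : VacExponents := ⟨0, 0, m', m'⟩

/-- projection of `detV`. [folklore] -/
@[simp] theorem detV_eP (m : ℤ) : (detV m).eP = m := rfl
/-- projection of `detV`. [folklore] -/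
@[simp] theorem detV_eQ (m : ℤ) : (detV m).eQ = m := rfl
/-- projection of `detV`. [folklore] -/
@[simp] theorem detV_eR (m : ℤ) : (detV m).eR = 0 := rfl
/-- projection of `detV`. [folklore] -/
@[simp] theorem detV_eS (m : ℤ) : (detV m).eS = 0 := rfl
/-- projection of `detW`. [folklore] -/
@[simp] theorem detW_eP (m' : ℤ) : (detW m').eP = 0 := rfl
/-- projection of `detW`. [folklore] -/
@[simp] theorem detW_eQ (m' : ℤ) : (detW m').eQ = 0 := rfl
/-- projection of `detW`. [folklore] -/
@[simp] theorem detW_eR (m' : ℤ) : (detW m').eR = m' := rfl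
/-- projection of `detW`. [folklore] -/
@[simp] theorem detW_eS (m' : ℤ) : (detW m').eS = m' := rfl

end VacExponents

/-- the determinant-power scalar of a sum of tuples is the product. [folklore] -/
theorem vacScalar_add (e e' : VacExponents) (k : DPK P Q R S) :
    vacScalar (e + e') k = vacScalar e k * vacScalar e' k := by
  have h1 := (Matrix.UnitaryGroup.det_isUnit k.1.1).ne_zero
  have h2 := (Matrix.UnitaryGroup.det_isUnit k.1.2).ne_zero
  have h3 := (Matrix.UnitaryGroup.det_isUnit k.2.1).ne_zero
  have h4 := (Matrix.UnitaryGroup.det_isUnit k.2.2).ne_zero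
  simp only [vacScalar, VacExponents.add_eP, VacExponents.add_eQ, VacExponents.add_eR, VacExponents.add_eS,
    zpow_add₀ h1, zpow_add₀ h2, zpow_add₀ h3, zpow_add₀ h4]
  ring

/-- `vacScalar (detV m) ((a,b),(c,d)) = (det a · det b) ^ m`. [folklore] -/
theorem vacScalar_detV (m : ℤ) (k : DPK P Q R S) :
    vacScalar (VacExponents.detV m) k = ((k.1.1 : Matrix P P ℂ).det * (k.1.2 : Matrix Q Q ℂ).det) ^ m := by
  simp [vacScalar, VacExponents.detV, mul_zpow]

/-- `vacScalar (detW m′) ((a,b),(c,d)) = (det c · det d) ^ m′`. [folklore] -/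
theorem vacScalar_detW (m' : ℤ) (k : DPK P Q R S) :
    vacScalar (VacExponents.detW m') k = ((k.2.1 : Matrix R R ℂ).det * (k.2.2 : Matrix S S ℂ).det) ^ m' := by
  simp [vacScalar, VacExponents.detW, mul_zpow]

namespace RealDualPairJunction

variable {D : RealDualPairJunction P Q R S Ginf}

/-- **Twisting the record.** If `ω` witnesses `D.FockVacuumCharacter e` and `χ` is a continuous unitary character of
`Ginf` which on the maximal compact `κ(K_V × K_W)` is the determinant-power character of `e'`, then `χ ⊗ ω` witnesses
`D.FockVacuumCharacter (e + e')`. [cite: KonnoKonno2007, Lemma 5.2 (i)/(ii) p. 73 with §3.3 p. 47, §4.1 p. 49]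
[cite: Folland1989, Ch. 4 §2, (4.23)] [folklore] -/
theorem FockVacuumCharacter.twist {e : VacExponents} (h : D.FockVacuumCharacter e) (χ : Ginf →* Circle)
    (hχ : Continuous χ) {e' : VacExponents} (hχκ : ∀ k : DPK P Q R S, ((χ (D.κ k) : Circle) : ℂ) = vacScalar e' k) :
    D.FockVacuumCharacter (e + e') := by
  obtain ⟨ω, hW, hvac⟩ := h
  refine ⟨charTwist (Circle.coeHom.comp χ) ω, hW.twist χ hχ, fun k => ?_⟩
  rw [charTwist_circle_apply, hvac k, smul_smul, hχκ k, vacScalar_add, mul_comm]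

/-- **The exponent family of a junction is closed under the two determinant twists.** Given continuous unitary
characters `χV m`, `χW m′` of `Ginf` (for all `m, m′ : ℤ`) restricting on the maximal compact to `(det a · det b)^m` and
`(det c · det d)^{m′}` — an instance supplies `det_{G_V}^m ∘ pr₁`, `det_{G_W}^{m′} ∘ pr₂` — the record for `e`
implies the record for `e + (m, m, m′, m′)`.
[cite: KonnoKonno2007, §3.3 p. 47, §4.1 p. 49, Lemma 5.2 p. 73] [folklore] -/
theorem FockVacuumCharacter.add_detV_detW {e : VacExponents} (h : D.FockVacuumCharacter e)
    (χV χW : ℤ → (Ginf →* Circle)) (hV : ∀ m, Continuous (χV m)) (hW : ∀ m', Continuous (χW m'))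
    (hVκ : ∀ (m : ℤ) (k : DPK P Q R S),
      ((χV m (D.κ k) : Circle) : ℂ) = ((k.1.1 : Matrix P P ℂ).det * (k.1.2 : Matrix Q Q ℂ).det) ^ m)
    (hWκ : ∀ (m' : ℤ) (k : DPK P Q R S),
      ((χW m' (D.κ k) : Circle) : ℂ) = ((k.2.1 : Matrix R R ℂ).det * (k.2.2 : Matrix S S ℂ).det) ^ m')
    (m m' : ℤ) : D.FockVacuumCharacter (e + VacExponents.detV m + VacExponents.detW m') :=
  (h.twist (χV m) (hV m) fun k => by rw [hVκ, vacScalar_detV]).twist (χW m') (hW m') fun k => by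
    rw [hWκ, vacScalar_detW]

/-- **Every tuple with the same differences is realised.** Under the hypotheses of `add_detV_detW`, if
`D.FockVacuumCharacter e` holds then `D.FockVacuumCharacter f` holds for every `f` with `f_P − f_Q = e_P − e_Q`,
`f_R − f_S = e_R − e_S` and `f_P − e_P = f_Q − e_Q`, `f_R − e_R = f_S − e_S` — i.e. for the whole affine family
`e + (m, m, m′, m′)`; the differences themselves are pinned by the junction's `SL₂`-frames (`JunctionVacuumCirclePin`).
[cite: KonnoKonno2007, §3.3 p. 47, §4.1 p. 49, Lemma 5.2 p. 73] [folklore] -/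
theorem FockVacuumCharacter.of_sub_eq_sub {e : VacExponents} (h : D.FockVacuumCharacter e)
    (χV χW : ℤ → (Ginf →* Circle)) (hV : ∀ m, Continuous (χV m)) (hW : ∀ m', Continuous (χW m'))
    (hVκ : ∀ (m : ℤ) (k : DPK P Q R S),
      ((χV m (D.κ k) : Circle) : ℂ) = ((k.1.1 : Matrix P P ℂ).det * (k.1.2 : Matrix Q Q ℂ).det) ^ m)
    (hWκ : ∀ (m' : ℤ) (k : DPK P Q R S),
      ((χW m' (D.κ k) : Circle) : ℂ) = ((k.2.1 : Matrix R R ℂ).det * (k.2.2 : Matrix S S ℂ).det) ^ m')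
    (f : VacExponents) (hPQ : f.eP - e.eP = f.eQ - e.eQ) (hRS : f.eR - e.eR = f.eS - e.eS) :
    D.FockVacuumCharacter f := by
  have key := h.add_detV_detW χV χW hV hW hVκ hWκ (f.eP - e.eP) (f.eR - e.eR)
  have hf : e + VacExponents.detV (f.eP - e.eP) + VacExponents.detW (f.eR - e.eR) = f := by
    obtain ⟨fP, fQ, fR, fS⟩ := f
    obtain ⟨eP, eQ, eR, eS⟩ := e
    dsimp only at hPQ hRS
    change (VacExponents.mk _ _ _ _) = _
    simp only [VacExponents.mk.injEq, VacExponents.add_eP, VacExponents.add_eQ, VacExponents.add_eR,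
      VacExponents.add_eS, VacExponents.detV, VacExponents.detW]
    omega
  rwa [hf] at key

end RealDualPairJunction

end Literature.RepresentationTheory.KonnoKonno2007

end
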